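import Summits.QuantumFields.YangMills.Theorems.TwistExponentGapLocalMorseBottCore
import Summits.QuantumFields.YangMills.Theorems.TwistExponentGapGaugeReduction
import Summits.QuantumFields.YangMills.Theorems.TwistExponentGapTwistedActionGaugeInvariant
import Summits.QuantumFields.YangMills.Theorems.TwistExponentGapRigidCeilingOfLocalMorseBott
import Summits.QuantumFields.YangMills.Theorems.EquipartitionCriticalityFreeEnergyLogCoefficientStubWeakCoupling
import Literature.MathematicalPhysics.QuantumFieldTheory.AdmissiblePlaquetteWeight
import HarnessLib

/-!
# `TwistExponentGap.RigidTwistCeiling` ⟨stmt-QuantumFields-24054⟩ — PROVED (Morse–Bott ceiling of the twisted partition function)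
# (crux file of route `TwistExponentGap`, LINE g13-A of planner ym-idea-4; free hands of width seat ym-line-sfw-p2-w3)

THE STATEMENT (route file): for every compact simple `G`, faithful lattice representation `r` (`D = dimE r.ρ`), inline twisted
partition function `Z`, side `S ≥ 2`, central `z ≠ 1` such that every pair `(x, y)` with `x y x⁻¹ y⁻¹ = z` has finite centraliser, and
plane `q`: there are `δ > 0`, `C`, `β₀` with `Z_{β,S}(z;q) ≤ C·β^{−((3S⁴−1)D/2 + δ)}` for `β ≥ β₀`.  Here `δ = D/2`.

THE PROOF (all in the tree, this seat 2026-08-30, everything `--supports 24054` except this file):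
layer cake (`laplace_of_sublevel`, ym-dw-p1 ✓p755406) ← sublevel volumes from quadratic growth off finitely many GAUGE orbits
(`GaugeOrbitTubeVolume`, `RigidCeilingOfMorseBott`) ← compactness: LOCAL quadratic growth at each twisted-flat `U₀` suffices
(`MorseBottCompactness`, `RigidCeilingOfLocalMorseBott`) ← gauge reduction to gauge-minimal configurations (`GaugeReduction`,
`TwistedActionGaugeInvariant`) ← the core inequality at gauge-minimal configurations (`LocalMorseBottCore`): exponential chart per
link (`ClosedSubgroupExpChart`), twisted plaquette cost `= ½‖(d¹X)_p‖² + O(|X|³)` (`TwistedPlaquetteCost`, `ColdBoxAllGroups` cubic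
remainder), Fermat in the gauge directions (`GaugeMinimalFirstOrder`), and the quantitative `h¹ = 0` (`HodgeConstant`) whose input —
INFINITESIMAL RIGIDITY of `z`-twisted-flat lattice connections under pair-rigidity — is `TwistedFlatRigidity` = `LatticeCocycle`
(the lattice deformation complex is the Koszul complex of the commuting covariant shifts; `KoszulRigidity`) + `CovConstOfFiniteStabilizer`
+ `StabilizerFinite` (non-abelian Stokes on the twisted slice, `CentralLadder`) + `PairRigidityAdFixed`.
Below: twisted flatness of `U₀` from `S_z(U₀) = 0` (`WeakCoupling.sub_re_trace_eq`: `N − Re tr = ½‖1 − ·‖²`, faithfulness), then the chain.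
HONEST LABEL: a RECORD-grade femto theorem on a fixed finite lattice (route `TwistExponentGap` is DRAFT and closes
`FixedTorusCriterionFailure` only together with `StratifiedTwistCeiling` ⟨24053⟩, OPEN); nothing here proves a rung of LADDER-YM,
the Yang–Mills mass gap, or any summit statement.
-/

set_option autoImplicit false

noncomputable section

open scoped Matrix Matrix.Norms.Frobenius Topology BigOperators
open Filter
open Literature.MathematicalPhysics.QuantumFieldTheory

namespace Summit.QuantumFields.YangMills.Theorems.TwistExponentGap

/-- **Crux `RigidTwistCeiling` ⟨stmt-QuantumFields-24054⟩.** -/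
theorem rigidTwistCeiling_proof : Summit.QuantumFields.YangMills.Theses.TwistExponentGap.RigidTwistCeiling := by
  refine rigidTwistCeiling_of_localMorseBott ?_
  intro G _ _ _ _ hG r L hL z hz hz1 hrig q U₀ hS0
  classical
  -- twisted flatness of `U₀` from the vanishing of its twisted action
  have hterm : ∀ p : Plaquette 4 (L + 1), 0 ≤ (r.N : ℝ) - (r.ρ ((if p.2 = q ∧ p.1 q.1.1 = 0 ∧ p.1 q.1.2 = 0 then z else 1) *
      plaquetteHolonomy U₀ p.1 p.2.1.1 p.2.1.2)).trace.re := fun p => traceDefect_nonneg r.ρ r.continuous _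
  have hzero := (Finset.sum_eq_zero_iff_of_nonneg fun p _ => hterm p).1 hS0
  have htf : ∀ p : Plaquette 4 (L + 1), (if p.2 = q ∧ p.1 q.1.1 = 0 ∧ p.1 q.1.2 = 0 then z else 1) *
      plaquetteHolonomy U₀ p.1 p.2.1.1 p.2.1.2 = 1 := by
    intro p
    have h0 := hzero p (Finset.mem_univ p)
    rw [FreeEnergyLogCoefficient.WeakCoupling.sub_re_trace_eq r.ρ r.mem_unitary] at h0
    have h1 : ‖1 - r.ρ ((if p.2 = q ∧ p.1 q.1.1 = 0 ∧ p.1 q.1.2 = 0 then z else 1) *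
        plaquetteHolonomy U₀ p.1 p.2.1.1 p.2.1.2)‖ = 0 := by
      have := sq_eq_zero_iff.1 (by linarith [h0] : ‖1 - r.ρ ((if p.2 = q ∧ p.1 q.1.1 = 0 ∧ p.1 q.1.2 = 0 then z else 1) *
        plaquetteHolonomy U₀ p.1 p.2.1.1 p.2.1.2)‖ ^ 2 = 0)
      exact this
    rw [norm_eq_zero, sub_eq_zero] at h1
    apply r.injective
    rw [map_one]
    exact h1.symm
  obtain ⟨ε₁, c, hε₁, hc, hcore⟩ := quadraticGrowth_of_gaugeMinimal r U₀ q z hz hrig htf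
  obtain ⟨N, hN, hMB⟩ := localMorseBott_of_gaugeMinimal r U₀
    (fun U => ∑ p : Plaquette 4 (L + 1), ((r.N : ℝ) - (r.ρ ((if p.2 = q ∧ p.1 q.1.1 = 0 ∧ p.1 q.1.2 = 0 then z else 1) *
      plaquetteHolonomy U p.1 p.2.1.1 p.2.1.2)).trace.re))
    (fun g U => twistedAction_gaugeTransform r.ρ q hz g U) hε₁ hcore
  exact ⟨N, hN, c, hc, hMB⟩

end Summit.QuantumFields.YangMills.Theorems.TwistExponentGap

end
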